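import Literature.AlgebraicTopology.SingularHomology.PinchCohomology
import Literature.NumberTheory.Transcendental.AnalytificationProjProofs
import Literature.NumberTheory.Transcendental.AnalytificationProper
import Summits.HodgeConjecture.HodgeConjecture.Theorems.NikulinTwinTransportAlgebraicClassesOneOneK3

/-!
# Route NikulinTwinTransport · `AlgebraicClassesOneOneK3` (stmt-HodgeConjecture-15041) —
# the curve slice of Deligne's kernel theorem, unconditionally

Sequel to `NikulinTwinTransportAlgebraicClassesOneOneK3` (the item reduced to (N1) de Rham
multiplicativity `exists_deRhamIsoFamily` and (N2) the curve slice `hK` of Deligne's Cor. 8.2.8).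
This file PROVES (N2) (`curveKernel`): for `S` smooth projective of dimension `2` over `ℂ` and
`V ⊆ S` closed irreducible of codimension `1`, with `g : C ⟶ S` a resolution of `V`,
`ker (H²(S(ℂ)) → H²((S ∖ V)(ℂ))) ⊆ im (g_* : H⁰(C(ℂ)) → H²(S(ℂ)))`. By the tree's transposition of
Cor. 8.2.8 to Prop. 8.2.7 in Čech form (`ker_restrictCompl_le_iSup_range_complexGysin_of_pullback`)
it suffices that a class `x' ∈ H²(S(ℂ))` with `g(ℂ)* x' = 0` vanishes near `V(ℂ) = g(ℂ)(C(ℂ))`.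
In degree `2` this needs no mixed Hodge theory: `g(ℂ)` is a PINCH MAP — a closed continuous
surjection from a compact surface, injective except on the finite set of complex points over the
points of `V` where the birational `π` is not an isomorphism (`exists_finite_exceptional`) — so by
the tree's pinch toolkit (`Literature/AlgebraicTopology/SingularHomology/Pinch*`) `V(ℂ)` is locally
contractible and `H²(V(ℂ)) → H²(C(ℂ))` is injective, whence `x'|_{V(ℂ)} = 0`, and tautness of
compact locally contractible subsets of the closed manifold `S(ℂ)` concludes.

Consequences: algebraic divisor classes on EVERY smooth projective complex surface are of type
`(1,1)` granted only `exists_deRhamIsoFamily` (`isOfHodgeType_oneOne_of_mem_algebraicClasses_of_deRham`),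
and the route decl from that single named fact (`algebraicClassesOneOneK3_of_deRham`).
-/

noncomputable section

-- `Summit.HodgeConjecture.HodgeConjecture.Theorems` is the mandated namespace (single-problem summit:
-- Problem = Summit), which `linter.dupNamespace` flags; the lakefile turns the linter off tree-wide
-- (weak option), restated here so stand-alone elaboration is warning-free too.
set_option linter.dupNamespace false

namespace Summit.HodgeConjecture.HodgeConjecture.Theorems.NikulinTwinTransport

open scoped Manifold
open CategoryTheory AlgebraicGeometry Topology
open Literature.AlgebraicGeometry Literature.AlgebraicGeometry.Motives
open Literature.AlgebraicGeometry.HodgeTheory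
open Literature.AlgebraicTopology.SingularHomology
open Literature.NumberTheory.Transcendental (exists_deRhamIsoFamily)

universe u v

/-! ### Tautness along a pinch map -/

/-- **A class killed by a pinch map vanishes near its image.** Let `f : N → M` be a continuous map
from a compact Hausdorff space charted on a proper real normed space to a closed topological
manifold, injective except on a finite set `F`. If `c ∈ H²(M; R)` has `f* c = 0`, then `c`
vanishes on an open neighbourhood of `f(N)`: the corestriction `q : N → f(N)` is a closed, hence
quotient, map, so `f(N)` is locally contractible (`Pinch.locallyContractibleSpace_of_pinch`) and
`q*` is injective on `H²` (`Pinch.singularCohomology_map_injective_two_of_pinch`), whence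
`c|_{f(N)} = 0`; conclude by tautness of compact locally contractible subsets of closed manifolds
(`exists_isOpen_map_subsetIncl_eq_zero_of_locallyContractibleSpace`, Spanier Thm. 6.1.10).
[cite: Spanier1981, Ch. 6 §1, Thm. 10] [cite: HatcherAT2002, §3.1 p. 204] -/
theorem exists_isOpen_map_subsetIncl_eq_zero_of_pinch
    {E : Type*} [NormedAddCommGroup E] [NormedSpace ℝ E] [ProperSpace E]
    {N : Type u} [TopologicalSpace N] [CompactSpace N] [T2Space N] [ChartedSpace E N]
    {M : Type u} [TopologicalSpace M] [CompactSpace M] [T2Space M] {d : ℕ}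
    [ChartedSpace (EuclideanSpace ℝ (Fin d)) M] {R : Type v} [CommRing R]
    (f : C(N, M)) {F : Set N} (hF : F.Finite)
    (hinj : ∀ ⦃a b : N⦄, f a = f b → a ≠ b → a ∈ F ∧ b ∈ F)
    (c : singularCohomology R R M 2) (hc : singularCohomology.map R R f 2 c = 0) :
    ∃ V : Set M, IsOpen V ∧ Set.range f ⊆ V ∧ singularCohomology.map R R (subsetIncl V) 2 c = 0 := by
  set K : Set M := Set.range f with hKdef
  have hK : IsClosed K := (isCompact_range f.continuous).isClosed
  let q : C(N, ↥K) := ⟨fun x ↦ ⟨f x, Set.mem_range_self x⟩, f.continuous.subtype_mk _⟩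
  have hqsurj : Function.Surjective q := by
    rintro ⟨_, x, rfl⟩
    exact ⟨x, rfl⟩
  have hq : IsQuotientMap q := q.continuous.isClosedMap.isQuotientMap q.continuous hqsurj
  have hinjq : ∀ ⦃a b : N⦄, q a = q b → a ≠ b → a ∈ F ∧ b ∈ F :=
    fun a b hab hne ↦ hinj (congrArg Subtype.val hab) hne
  have hLC : LocallyContractibleSpace ↥K := Pinch.locallyContractibleSpace_of_pinch E hq hF hinjq
  have hinj2 : Function.Injective (singularCohomology.map R R q 2) :=
    Pinch.singularCohomology_map_injective_two_of_pinch (E := E) R q hq hF hinjq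
  have hcK : singularCohomology.map R R (subsetIncl K) 2 c = 0 := by
    apply hinj2
    have hfq : (subsetIncl K).comp q = f := by ext x; rfl
    rw [map_zero, ← ModuleCat.comp_apply, ← singularCohomology.map_comp, hfq, hc]
  exact exists_isOpen_map_subsetIncl_eq_zero_of_locallyContractibleSpace (d := d) hK hLC c hcK

/-! ### Closed points and finiteness -/

/-- A point of height `0` in a scheme is a closed point (it is minimal for specialisation, and
schemes are `T₀`). [folklore] -/
theorem isClosed_singleton_of_height_eq_zero'' {Y : Scheme} {x : Y} (hx : Order.height x = 0) :
    IsClosed ({x} : Set Y) := by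
  rw [Order.height_eq_zero] at hx
  rw [← closure_subset_iff_isClosed]
  intro y hy
  have hs : x ⤳ y := specializes_iff_mem_closure.2 hy
  have hle : y ≤ x := Scheme.le_iff_specializes.2 hs
  have hge : x ≤ y := hx hle
  exact Set.mem_singleton_iff.2 (hs.antisymm (Scheme.le_iff_specializes.1 hge)).eq.symm

/-- A closed point has height `0`. [folklore] -/
theorem height_eq_zero_of_isClosed_singleton' {Y : Scheme} {x : Y} (hx : IsClosed ({x} : Set Y)) :
    Order.height x = 0 := by
  rw [Order.height_eq_zero]
  intro y hy
  have hs : x ⤳ y := Scheme.le_iff_specializes.mp hy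
  have hy' : y ∈ closure ({x} : Set Y) := hs.mem_closure
  rw [hx.closure_eq, Set.mem_singleton_iff] at hy'
  exact hy'.symm.le

/-- **In a Noetherian space, a closed set all of whose points are closed is finite**: its finitely
many irreducible components are the closures of their generic points, which are points.
[folklore] -/
theorem finite_of_isClosed_of_forall_isClosed_singleton {Y : Type*} [TopologicalSpace Y]
    [TopologicalSpace.NoetherianSpace Y] [QuasiSober Y] {T : Set Y} (hT : IsClosed T)
    (h : ∀ t ∈ T, IsClosed ({t} : Set Y)) : T.Finite := by
  obtain ⟨S, hSfin, hSclosed, hSirr, rfl⟩ :=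
    TopologicalSpace.NoetherianSpace.exists_finite_set_isClosed_irreducible hT
  refine (hSfin.biUnion fun s hs ↦ ?_ : (⋃ s ∈ S, s).Finite).subset (by rw [Set.sUnion_eq_biUnion])
  set z := (hSirr s hs).genericPoint
  have hz : closure {z} = s := (hSirr s hs).closure_genericPoint (hSclosed s hs)
  have hzT : z ∈ ⋃₀ S := Set.subset_sUnion_of_mem hs (hz.le (subset_closure (Set.mem_singleton z)))
  rw [← hz, (h z hzT).closure_eq]
  exact Set.finite_singleton z

section Curve

variable {C : SchemeOver ℂ}

/-- On a smooth projective curve every point other than the generic point is closed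
(`height + coheight = 1`, and a point of coheight `0` is the generic point). [folklore] -/
theorem isClosed_singleton_of_ne_genericPoint (hC : IsSmoothProjective 1 C) [IrreducibleSpace C.left]
    {c : C.left} (hc : c ≠ genericPoint C.left) : IsClosed ({c} : Set C.left) := by
  obtain ⟨a, b, ha, hb, hab⟩ := exists_height_eq_coheight_eq hC c
  have hb0 : b ≠ 0 := by
    rintro rfl
    have hmax : IsMax c := Order.coheight_eq_zero.1 (by rw [hb]; rfl)
    apply hc
    have hle : c ≤ genericPoint C.left :=
      Scheme.le_iff_specializes.2 ((genericPoint_spec C.left).specializes (Set.mem_univ c))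
    have hge := hmax hle
    exact ((Scheme.le_iff_specializes.1 hge).antisymm (Scheme.le_iff_specializes.1 hle)).eq
  have ha0 : a = 0 := by omega
  exact isClosed_singleton_of_height_eq_zero'' (by rw [ha, ha0]; rfl)

end Curve

section Surface

variable {S : SchemeOver ℂ}

/-- On a smooth projective surface, a point of the closure of a point `x` of height `1`, other than
`x`, is a closed point (`height` is strictly monotone on finite heights). [folklore] -/
theorem isClosed_singleton_of_mem_closure_of_ne (hS : IsSmoothProjective 2 S) {x z : S.left}
    (hx : Order.height x = 1) (hz : z ∈ closure ({x} : Set S.left)) (hne : z ≠ x) :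
    IsClosed ({z} : Set S.left) := by
  have hs : x ⤳ z := specializes_iff_mem_closure.2 hz
  have hle : z ≤ x := Scheme.le_iff_specializes.2 hs
  have hlt : z < x :=
    lt_iff_le_not_ge.2 ⟨hle, fun hge ↦ hne ((Scheme.le_iff_specializes.1 hge).antisymm hs).eq⟩
  obtain ⟨a, b, ha, -, -⟩ := exists_height_eq_coheight_eq hS z
  have hfin : Order.height z < ⊤ := by rw [ha]; exact ENat.coe_lt_top a
  have h := Order.height_strictMono hlt hfin
  rw [hx, ha] at h
  have ha0 : a = 0 := by
    have : (a : ℕ∞) < 1 := h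
    have : a < 1 := by exact_mod_cast this
    omega
  exact isClosed_singleton_of_height_eq_zero'' (by rw [ha, ha0]; rfl)

/-- **The exceptional set of a resolution of an irreducible curve is finite.** Let `S` be a smooth
projective surface, `V = closure {x} ⊆ S` an irreducible closed curve (`height x = 1`) with its
reduced structure `ofPoint S x`, `C` a smooth projective curve and `π : C ⟶ ofPoint S x`
birational (an isomorphism over a dense open `U`). Then there is a FINITE set `F ⊆ C(ℂ)` such
that the composite `g = π ≫ ι : C ⟶ S` is injective on complex points except on `F`: the image of
the complement of `U` is a closed set of closed points of the Noetherian `S`, hence finite, and so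
is its preimage in the curve `C`; two complex points with the same image either lie over `U`,
where `π` is an isomorphism, or over the complement. [cite: StacksProject, Tag 01RN]
[cite: Hartshorne1977, II Ex. 3.20] -/
theorem exists_finite_exceptional (hS : IsSmoothProjective 2 S) {x : S.left} (hx : Order.height x = 1)
    {C : SchemeOver ℂ} (hC : IsSmoothProjective 1 C)
    (π : C ⟶ (ClosedSubvariety.ofPoint S.left x).toSchemeOver) (hπ : Resolution.IsBirational π.left) :
    ∃ F : Set (ComplexPoints C), F.Finite ∧ ∀ ⦃P Q : ComplexPoints C⦄,
      AlgPoints.map (π ≫ (ClosedSubvariety.ofPoint S.left x).ιOver) P =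
        AlgPoints.map (π ≫ (ClosedSubvariety.ofPoint S.left x).ιOver) Q → P ≠ Q → P ∈ F ∧ Q ∈ F := by
  classical
  haveI : IsIntegral (ClosedSubvariety.ofPoint S.left x).toSchemeOver.left :=
    inferInstanceAs (IsIntegral (ClosedSubvariety.ofPoint S.left x).carrier)
  haveI : IrreducibleSpace (ClosedSubvariety.ofPoint S.left x).toSchemeOver.left := inferInstance
  haveI := irreducibleSpace_of_isSmoothProjective' hC
  haveI := noetherianSpace_of_isSmoothProjective hS
  haveI := noetherianSpace_of_isSmoothProjective hC
  haveI := locallyOfFiniteType_of_isSmoothProjective hC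
  have hπξ : π.left.base (genericPoint C.left) =
      genericPoint (ClosedSubvariety.ofPoint S.left x).toSchemeOver.left :=
    base_genericPoint_of_isBirational hπ
  obtain ⟨U, hUd, -, hiso⟩ := hπ
  have hιinj : Function.Injective (ClosedSubvariety.ofPoint S.left x).ι.base :=
    (ClosedSubvariety.ofPoint S.left x).ι.isClosedEmbedding.injective
  have hιx : (ClosedSubvariety.ofPoint S.left x).ι.base
      (genericPoint (ClosedSubvariety.ofPoint S.left x).toSchemeOver.left) = x :=
    ClosedSubvariety.genericPoint_ofPoint x
  have hrange : Set.range (ClosedSubvariety.ofPoint S.left x).ι.base = closure {x} :=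
    ClosedSubvariety.range_ofPoint_ι x
  have hgl : ∀ c : C.left, (π ≫ (ClosedSubvariety.ofPoint S.left x).ιOver).left.base c =
      (ClosedSubvariety.ofPoint S.left x).ι.base (π.left.base c) := fun c ↦ rfl
  -- the generic point of `ofPoint S x` lies in `U`
  have hξU : genericPoint (ClosedSubvariety.ofPoint S.left x).toSchemeOver.left ∈ U := by
    have hne : ((⊤ : Set (ClosedSubvariety.ofPoint S.left x).toSchemeOver.left) ∩ U).Nonempty := by
      rw [Set.top_eq_univ, Set.univ_inter]; exact hUd.nonempty
    exact ((genericPoint_spec (ClosedSubvariety.ofPoint S.left x).toSchemeOver.left).mem_open_set_iff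
      U.isOpen).2 hne
  -- `T = ι(complement of U) ⊆ S`: a closed set of closed points, hence finite
  set T : Set S.left := (ClosedSubvariety.ofPoint S.left x).ι.base ''
    (U : Set (ClosedSubvariety.ofPoint S.left x).toSchemeOver.left)ᶜ with hTdef
  have hxT : x ∉ T := by
    rintro ⟨u, hu, hux⟩
    apply hu
    have : u = genericPoint (ClosedSubvariety.ofPoint S.left x).toSchemeOver.left :=
      hιinj (hux.trans hιx.symm)
    rw [this]; exact hξU
  have hTc : IsClosed T :=
    (ClosedSubvariety.ofPoint S.left x).ι.isClosedEmbedding.isClosedMap _ U.isOpen.isClosed_compl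
  have hTfin : T.Finite := by
    refine finite_of_isClosed_of_forall_isClosed_singleton hTc fun t ht ↦ ?_
    have htV : t ∈ closure ({x} : Set S.left) := by
      rw [← hrange]; obtain ⟨u, -, rfl⟩ := ht; exact ⟨u, rfl⟩
    exact isClosed_singleton_of_mem_closure_of_ne hS hx htV (fun h ↦ hxT (h ▸ ht))
  -- `F₀ = g⁻¹(T) ⊆ C`: a closed set of closed points of the curve, hence finite
  set F₀ : Set C.left := (fun c ↦ (ClosedSubvariety.ofPoint S.left x).ι.base (π.left.base c)) ⁻¹' T
    with hF₀def
  have hF₀c : IsClosed F₀ := hTc.preimage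
    ((ClosedSubvariety.ofPoint S.left x).ι.base.hom.continuous.comp π.left.base.hom.continuous)
  have hF₀fin : F₀.Finite := by
    refine finite_of_isClosed_of_forall_isClosed_singleton hF₀c fun c hc ↦
      isClosed_singleton_of_ne_genericPoint hC fun h ↦ hxT ?_
    have hc' : (ClosedSubvariety.ofPoint S.left x).ι.base (π.left.base c) ∈ T := hc
    rwa [h, hπξ, hιx] at hc'
  refine ⟨AlgPoints.pt ⁻¹' F₀, hF₀fin.preimage fun P _ Q _ h ↦ ComplexPoints.ext_of_pt_eq h,
    fun P Q hPQ hne ↦ ?_⟩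
  have hpt : P.pt ≠ Q.pt := fun h ↦ hne (ComplexPoints.ext_of_pt_eq h)
  have hg : (ClosedSubvariety.ofPoint S.left x).ι.base (π.left.base P.pt) =
      (ClosedSubvariety.ofPoint S.left x).ι.base (π.left.base Q.pt) := by
    have h := congrArg AlgPoints.pt hPQ
    rw [AlgPoints.pt_map, AlgPoints.pt_map, hgl, hgl] at h
    exact h
  have hπPQ : π.left.base P.pt = π.left.base Q.pt := hιinj hg
  by_cases hv : π.left.base P.pt ∈ U
  · exfalso -- over `U`, `π` is an isomorphism
    apply hpt
    have hP : P.pt ∈ π.left ⁻¹ᵁ U := hv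
    have hQ : Q.pt ∈ π.left ⁻¹ᵁ U := show π.left.base Q.pt ∈ U by rw [← hπPQ]; exact hv
    haveI := hiso
    have hinjU : Function.Injective (π.left ∣_ U).base :=
      (Scheme.homeoOfIso (asIso (π.left ∣_ U))).injective
    have heq : (π.left ∣_ U).base ⟨P.pt, hP⟩ = (π.left ∣_ U).base ⟨Q.pt, hQ⟩ := by
      apply Subtype.ext
      rw [morphismRestrict_base_coe, morphismRestrict_base_coe]
      exact hπPQ
    exact congrArg Subtype.val (hinjU heq)
  · have hPT : (ClosedSubvariety.ofPoint S.left x).ι.base (π.left.base P.pt) ∈ T := ⟨_, hv, rfl⟩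
    refine ⟨hPT, ?_⟩
    change (ClosedSubvariety.ofPoint S.left x).ι.base (π.left.base Q.pt) ∈ T
    rw [← hπPQ]; exact hPT

/-- **The complex points over an irreducible curve are the images of the complex points of a
resolution**: with `g = π ≫ ι : C ⟶ S` as above (`g` onto `V = closure {x}`),
`{P ∈ S(ℂ) | pt P ∈ V} = g(ℂ)(C(ℂ))` — a complex point of `S` lying on `V` lies under a CLOSED
point of `C` (the generic point of `C` maps to the non-closed point `x`), which underlies a complex
point of `C` (Nullstellensatz, `AlgPoints.exists_pt_eq_of_isClosed`). [folklore] -/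
theorem range_map_eq_setOf_pt_mem (hS : IsSmoothProjective 2 S) {x : S.left} (hx : Order.height x = 1)
    {C : SchemeOver ℂ} (hC : IsSmoothProjective 1 C)
    (π : C ⟶ (ClosedSubvariety.ofPoint S.left x).toSchemeOver) (hπ : Resolution.IsBirational π.left)
    (hsurj : Set.range (π ≫ (ClosedSubvariety.ofPoint S.left x).ιOver).left.base = closure {x}) :
    Set.range (AlgPoints.map (L := ℂ) (π ≫ (ClosedSubvariety.ofPoint S.left x).ιOver)) =
      {P : ComplexPoints S | P.pt ∈ closure {x}} := by
  haveI : IsIntegral (ClosedSubvariety.ofPoint S.left x).toSchemeOver.left :=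
    inferInstanceAs (IsIntegral (ClosedSubvariety.ofPoint S.left x).carrier)
  haveI : IrreducibleSpace (ClosedSubvariety.ofPoint S.left x).toSchemeOver.left := inferInstance
  haveI := irreducibleSpace_of_isSmoothProjective' hC
  haveI := locallyOfFiniteType_of_isSmoothProjective hC
  haveI := locallyOfFiniteType_of_isSmoothProjective hS
  have hgξ : (π ≫ (ClosedSubvariety.ofPoint S.left x).ιOver).left.base (genericPoint C.left) = x := by
    change (ClosedSubvariety.ofPoint S.left x).ι.base (π.left.base (genericPoint C.left)) = x
    rw [base_genericPoint_of_isBirational hπ]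
    exact ClosedSubvariety.genericPoint_ofPoint x
  refine Set.Subset.antisymm ?_ fun P hP ↦ ?_
  · rintro _ ⟨Q, rfl⟩
    change (AlgPoints.map (π ≫ (ClosedSubvariety.ofPoint S.left x).ιOver) Q).pt ∈ closure {x}
    rw [AlgPoints.pt_map, ← hsurj]
    exact ⟨Q.pt, rfl⟩
  · have hP' : P.pt ∈ Set.range (π ≫ (ClosedSubvariety.ofPoint S.left x).ιOver).left.base := by
      rw [hsurj]; exact hP
    obtain ⟨c, hc⟩ := hP'
    have hcξ : c ≠ genericPoint C.left := by
      rintro rfl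
      rw [hgξ] at hc
      have h0 := height_eq_zero_of_isClosed_singleton' (hc ▸ ComplexPoints.isClosed_pt P)
      rw [hx] at h0
      exact one_ne_zero h0
    obtain ⟨Q, hQ⟩ := AlgPoints.exists_pt_eq_of_isClosed (X := C) (L := ℂ) c
      (isClosed_singleton_of_ne_genericPoint hC hcξ)
    refine ⟨Q, ComplexPoints.ext_of_pt_eq ?_⟩
    rw [AlgPoints.pt_map, hQ, hc]

/-! ### The curve slice of Deligne's kernel theorem -/

/-- **The curve slice of Deligne, *Hodge III*, Cor. 8.2.8, unconditionally.** For `S` smooth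
projective of dimension `2` over `ℂ`, `V ⊆ S` closed irreducible with generic point of codimension
`1`, and every orientation family `μ`, there is a morphism `g : C ⟶ S` from a smooth projective
curve (a resolution of `V`) with
`ker (H²(S(ℂ); ℂ) → H²((S ∖ V)(ℂ); ℂ)) ⊆ im (g_* : H⁰(C(ℂ); ℂ) → H²(S(ℂ); ℂ))` — the hypothesis
`hK` of `isOfHodgeType_oneOne_of_mem_algebraicClasses_of_curveKernel`. Proof: by the tree's
transposition of Cor. 8.2.8 to Prop. 8.2.7 in Čech form
(`ker_restrictCompl_le_iSup_range_complexGysin_of_pullback`) it suffices that a class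
`x' ∈ H²(S(ℂ))` with `g(ℂ)* x' = 0` vanishes near `V(ℂ) = g(ℂ)(C(ℂ))`
(`range_map_eq_setOf_pt_mem`); `g(ℂ)` is a pinch map (`exists_finite_exceptional`), so this is
`exists_isOpen_map_subsetIncl_eq_zero_of_pinch`. [cite: DeligneHodgeIII1974, Prop. 8.2.7 and Cor. 8.2.8]
[cite: Fulton1998, §19.1 Lemma 19.1.1] -/
theorem curveKernel (μ : OrientationFamily) ⦃S : SchemeOver ℂ⦄ (hS : IsSmoothProjective 2 S)
    (V : Set S.left) (hV : IsClosed V) (hirr : IsIrreducible V)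
    (hgen : Order.coheight hirr.genericPoint = 1) :
    ∃ (C : SchemeOver ℂ) (hC : IsSmoothProjective 1 C) (g : C ⟶ S),
      LinearMap.ker (complexBetti.restrictCompl S V (2 * 1)).hom ≤
        LinearMap.range (complexGysin μ hC hS g (rfl : 0 + 2 * 2 = 2 * 1 + 2 * 1)) := by
  obtain ⟨C, hC, π, hπ, hrange⟩ := exists_resolution_of_irreducible_curve hS hV hirr hgen
  have hxV : closure {hirr.genericPoint} = V := hirr.closure_genericPoint hV
  have hx1 : Order.height hirr.genericPoint = 1 := by
    obtain ⟨a, c, ha, hc, hac⟩ := exists_height_eq_coheight_eq hS hirr.genericPoint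
    rw [hc] at hgen
    have hc1 : c = 1 := by exact_mod_cast hgen
    rw [ha, show a = 1 by omega]
    rfl
  refine ⟨C, hC, π ≫ (ClosedSubvariety.ofPoint S.left hirr.genericPoint).ιOver, ?_⟩
  obtain ⟨F, hF, hinj⟩ := exists_finite_exceptional hS hx1 hC π hπ
  have hsurj : Set.range (π ≫ (ClosedSubvariety.ofPoint S.left hirr.genericPoint).ιOver).left.base = closure {hirr.genericPoint} :=
    hrange.trans hxV.symm
  have hptrange := range_map_eq_setOf_pt_mem hS hx1 hC π hπ hsurj
  letI := hS.chartedSpace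
  letI := hC.chartedSpace
  haveI := Motives.ComplexPoints.compactSpace_of_isSmoothProjective hS
  haveI := Motives.ComplexPoints.t2Space_of_isSmoothProjective hS
  haveI := Motives.ComplexPoints.compactSpace_of_isSmoothProjective hC
  haveI := Motives.ComplexPoints.t2Space_of_isSmoothProjective hC
  have H : ∀ x' : complexBetti S 2,
      (∀ _ : Unit, complexBetti.map (π ≫ (ClosedSubvariety.ofPoint S.left hirr.genericPoint).ιOver) 2 x' = 0) →
      ∃ W : Set (ComplexPoints S), IsOpen W ∧
        {P | P.pt ∈ ⋃ _ : Unit, Set.range (π ≫ (ClosedSubvariety.ofPoint S.left hirr.genericPoint).ιOver).left.base} ⊆ W ∧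
        singularCohomology.map ℂ ℂ (subsetIncl W) 2 x' = 0 := by
    intro x' hx'
    obtain ⟨W, hWo, hKW, hW⟩ := exists_isOpen_map_subsetIncl_eq_zero_of_pinch
      (E := EuclideanSpace ℝ (Fin (2 * 1))) (d := 2 * 2)
      (AlgPoints.mapContinuous (L := ℂ) (π ≫ (ClosedSubvariety.ofPoint S.left hirr.genericPoint).ιOver)) hF
      (fun a b hab hne ↦ hinj hab hne) x' (hx' ())
    refine ⟨W, hWo, fun P hP ↦ hKW ?_, hW⟩
    have hP' : P.pt ∈ closure {hirr.genericPoint} := by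
      rw [Set.mem_setOf_eq, Set.iUnion_const, hsurj] at hP
      exact hP
    have hP'' : P ∈ Set.range (AlgPoints.map (L := ℂ) (π ≫ (ClosedSubvariety.ofPoint S.left hirr.genericPoint).ιOver)) := by
      rw [hptrange]; exact hP'
    exact hP''
  have key := ker_restrictCompl_le_iSup_range_complexGysin_of_pullback μ hS (ι := Unit)
    (m := fun _ ↦ 1) (Y := fun _ ↦ C) (fun _ ↦ hC) (fun _ ↦ π ≫ (ClosedSubvariety.ofPoint S.left hirr.genericPoint).ιOver)
    (b := 2 * 1) (q := 2) (by norm_num) H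
  have hset : (⋃ _ : Unit, Set.range (π ≫ (ClosedSubvariety.ofPoint S.left hirr.genericPoint).ιOver).left.base) = V := by
    rw [Set.iUnion_const, hsurj, hxV]
  rw [hset] at key
  refine key.trans (iSup_le fun j ↦ iSup_le fun a ↦ iSup_le fun hab ↦ ?_)
  obtain rfl : a = 0 := by change a + 2 * 2 = 2 * 1 + 2 * 1 at hab; omega
  exact le_rfl

end Surface

/-! ### Consequences: the item granted de Rham multiplicativity only -/

/-- **Algebraic divisor classes on every smooth projective complex surface are of type `(1,1)`,
granted only de Rham's theorem in multiplicative form** (`exists_deRhamIsoFamily`, for the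
bidegree `(1,1)` of the Gysin morphisms `g_* : H⁰(C(ℂ)) → H²(S(ℂ))`): the curve slice of Deligne's
kernel theorem (`curveKernel`) fed to `isOfHodgeType_oneOne_of_mem_algebraicClasses_of_curveKernel`.
[cite: VoisinHodgeI2002, Prop. 11.20 and §7.3.2] [cite: Fulton1998, §19.1 Lemma 19.1.1] -/
theorem isOfHodgeType_oneOne_of_mem_algebraicClasses_of_deRham
    (hdR : ∀ (E : Type) [NormedAddCommGroup E] [NormedSpace ℂ E] [FiniteDimensional ℂ E],
      exists_deRhamIsoFamily 𝓘(ℝ, E))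
    ⦃S : SchemeOver ℂ⦄ (hS : IsSmoothProjective 2 S) ⦃d : complexBetti S (2 * 1)⦄
    (hd : d ∈ algebraicClasses S 1) : IsOfHodgeType 2 S (2 * 1) 1 1 d :=
  let μ : OrientationFamily := fun _ _ hY ↦ (ComplexPoints.isOrientableOver ℂ hY).some
  isOfHodgeType_oneOne_of_mem_algebraicClasses_of_curveKernel hdR μ (curveKernel μ) hS hd

/-- **`AlgebraicClassesOneOneK3` from the single named fact `exists_deRhamIsoFamily`** (de Rham's
theorem in multiplicative form, Warner Thm. 5.45) — the route decl by name; the K3 hypotheses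
beyond `IsSmoothProjective 2 S` are not used. [cite: VoisinHodgeI2002, Prop. 11.20]
[cite: WarnerGTM94, Thm. 5.45] -/
theorem algebraicClassesOneOneK3_of_deRham
    (hdR : ∀ (E : Type) [NormedAddCommGroup E] [NormedSpace ℂ E] [FiniteDimensional ℂ E],
      exists_deRhamIsoFamily 𝓘(ℝ, E)) :
    Theses.NikulinTwinTransport.AlgebraicClassesOneOneK3 :=
  fun _ hS _ hd ↦ isOfHodgeType_oneOne_of_mem_algebraicClasses_of_deRham hdR hS.1 hd

end Summit.HodgeConjecture.HodgeConjecture.Theorems.NikulinTwinTransport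

end
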